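import Summits.BirchSwinnertonDyer.BirchSwinnertonDyer.Theorems.Rank2ObservatoryCubicFieldR209972
import HarnessLib

/-!
# BirchSwinnertonDyer — rank ≥ 2 observatory: class number one of the cubic field of `-45 + 77 * X - 19 * X ^ 2 + X ^ 3` (`Δ = 209972`) — certificates at the primes 113, 127

HONEST FRAMING: per-curve certified theorems and census instruments; no claim on BSD in rank ≥ 2.

Companion of the per-FIELD file `Rank2ObservatoryCubicFieldR209972` of the KERNEL-2DESC instrument (design
`b2b-bsdr2-cert-3/KERNEL-2DESC.md` §9e–§9g): the degree-one prime-element certificates at the primes 113, 127 (part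
b). Split off for file size; generated by the same generator from the same checked data.
Sorry-free; axioms `propext`, `Classical.choice`, `Quot.sound`.
[cite: Marcus2018, Ch. 3 Thm. 27, Ch. 5 Cor. 2 of Thm. 37]
-/

-- single-conjunct summit: `Summit.BirchSwinnertonDyer.BirchSwinnertonDyer.…` repeats the name by design
set_option linter.dupNamespace false

noncomputable section

open scoped Classical NumberField

open Literature.NumberTheory.NumberFields Polynomial Module NumberField

namespace Summit.BirchSwinnertonDyer.BirchSwinnertonDyer.Rank2Observatory.TwoDescCubic

namespace FieldR209972

/-! ## Class number one -/

/-- Certificate at `113`: every ring map `ψ : 𝓞 K → ℤ/113` kills a prime element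
(`α ↦ 18`: `-469 - 74 * α + 8 * α ^ 2` (norm `113`); `α ↦ 23`: `-97 + 75 * α - 5 * α ^ 2` (norm `-113`); `α ↦ 91`: `2909 - 4109 * α + 287 * α ^ 2` (norm `113`)). [cite: Marcus2018, Ch. 3, Thm. 27] -/
theorem cert113 (ψ : 𝓞 (CubicField (-19) 77 (-45)) →+* ZMod 113) : ∃ e : 𝓞 (CubicField (-19) 77 (-45)), ψ e = 0 ∧ Prime e := by
  refine cert_of_cases aeval_α ψ (fun t ht hF => ?_)
  have hroots : ∀ t : ZMod 113,
      t ^ 3 + (((-19) : ℤ) : ZMod 113) * t ^ 2 + ((77 : ℤ) : ZMod 113) * t + (((-45) : ℤ) : ZMod 113) = 0 → t = 18 ∨ t = 23 ∨ t = 91 := by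
    decide +kernel
  rcases hroots t hF with rfl | rfl | rfl
  · exact ⟨lin aeval_α (-469) (-74) 8, by simp only [lin, map_add, map_mul, map_pow, map_intCast, ht]; decide,
      lin_prime_of_prime irreducible aeval_α finrank_eq (-469) (-74) 8 (n := 113)
        (by norm_num [MonicCubic.normForm]) (by norm_num)⟩
  · exact ⟨lin aeval_α (-97) 75 (-5), by simp only [lin, map_add, map_mul, map_pow, map_intCast, ht]; decide,
      lin_prime_of_prime irreducible aeval_α finrank_eq (-97) 75 (-5) (n := (-113))
        (by norm_num [MonicCubic.normForm]) (by norm_num)⟩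
  · exact ⟨lin aeval_α 2909 (-4109) 287, by simp only [lin, map_add, map_mul, map_pow, map_intCast, ht]; decide,
      lin_prime_of_prime irreducible aeval_α finrank_eq 2909 (-4109) 287 (n := 113)
        (by norm_num [MonicCubic.normForm]) (by norm_num)⟩

/-- Certificate at `127`: `g` has no root mod `127`, so there is no ring map `𝓞 K → ℤ/127`. [folklore] -/
theorem cert127 (ψ : 𝓞 (CubicField (-19) 77 (-45)) →+* ZMod 127) : ∃ e : 𝓞 (CubicField (-19) 77 (-45)), ψ e = 0 ∧ Prime e :=
  cert_of_no_root aeval_α ψ (by decide +kernel)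

end FieldR209972

end Summit.BirchSwinnertonDyer.BirchSwinnertonDyer.Rank2Observatory.TwoDescCubic

end
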